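import Summits.AtomisticToContinuum.FouriersLaw.Theses.VanishingNoiseTransfer
import Summits.AtomisticToContinuum.FouriersLaw.Theorems.OddSectorIrreversibilityOddDensityIsCorrectorStationarity
import Summits.AtomisticToContinuum.FouriersLaw.Theorems.BondHeatUncertaintyLightConeBondHeatGibbsByParts
import Literature.MathematicalPhysics.KineticTheory.VelocityFlipNoise

/-!
# Response density of the flip-noisy steady family from an a priori `L²` bound and `L²`-uniqueness
of the linearised equation (helpers for stub `stub_responseDensityNoisy`), part A: tools

Helper file `--supports stmt-AtomisticToContinuum-11975` (crux `NoiseLocality`, route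
`VanishingNoiseTransfer`, line `relative-flip-energy-transfer`, stub 1b `stub_responseDensityNoisy`).

Tools for the compactness-plus-uniqueness derivation of the linear-response density of the
flip-noisy chain `L + εS` (part B, file `…StubResponseDensityNoisyAux3`, theorem
`of_apriori_of_unique`):

* `flipGenerator_temp_split` — the flip-noisy generator is affine in the bath temperatures:
  `(L_{T+δ/2,T-δ/2} + εS) f = (L_{T,T} + εS) f + δ · V f`,
  `V f = γ ∑_i ([i=0]½ - [i=N-1]½) ∂²_{p_i} f` (any chain, any `N`);
* `hasCompactSupport_finset_sum`, `memLp_of_continuous_hasCompactSupport`,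
  `hasCompactSupport_flipGenerator` / `continuous_flipGenerator` / `memLp_flipGenerator`,
  `continuous_tempDeriv` / `hasCompactSupport_tempDeriv` / `memLp_tempDeriv` — the test vectors
  `(L+εS) f`, `V f` (`f ∈ C_c^∞`) are continuous with compact support, hence in `L²(μ_T)`;
* `memLp_bondCurrent_gibbsMeasure` (registered helper sub-goal
  `helper_responseDensityNoisyMemLpBondCurrent`) — the bond currents of the pinned chain are in
  `L²(μ_T)` (`|j_i| ≤ N(3+β)/2 (1+H)²` and `(1+H)^4 e^{-H/T} ∈ L¹`), so the current clause of the
  stub is a special case of the `L²`-observable clause;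
* `inner_toLp_eq_integral`, `inner_toLp_toLp_eq_integral`, `norm_toLp_le_sqrt` — the `L²(μ_T)`
  inner product / norm of `MemLp.toLp` representatives as integrals;
* `exists_tendsto_inner_of_norm_le` — the abstract Hilbert-space lemma: a net `v i` bounded along
  a filter, whose inner products against a family `e j` converge to `c j`, converges WEAKLY to the
  unique solution `u` of `⟪u, e j⟫ = c j` as soon as that system has at most one solution
  (Banach–Alaoglu in the weak dual, `WeakDual.isCompact_closedBall`, via the Riesz isometry
  `InnerProductSpace.toDual`; every weak-* cluster point solves the system, so the cluster point is
  unique and `IsCompact.tendsto_nhds_of_unique_mapClusterPt` applies).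

No definitions.
-/

noncomputable section

open MeasureTheory Filter Topology
open scoped ContDiff InnerProductSpace

namespace Summit.AtomisticToContinuum.FouriersLaw.Theorems.NoiseLocality.StubResponseDensityNoisy

open Literature.MathematicalPhysics.KineticTheory.HeatConduction
open Summit.AtomisticToContinuum.FouriersLaw.Theorems.OddSectorIrreversibility

variable {N : ℕ}

/-! ### The flip-noisy generator is affine in the bath temperatures -/

/-- `(L_{T+δ/2,T-δ/2} + εS) f = (L_{T,T} + εS) f + δ · γ ∑_i ([i=0]½ ∂²_{p_i} f - [i=N-1]½ ∂²_{p_i} f)`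
pointwise, for every chain, rate and `f` (the flip part does not involve the temperatures;
`generator_temp_split`). -/
theorem flipGenerator_temp_split (P : OscillatorChain) (N : ℕ) (T δ ε : ℝ) (f : PhaseSpace N → ℝ)
    (x : PhaseSpace N) :
    P.flipGenerator N (T + δ / 2) (T - δ / 2) ε f x = P.flipGenerator N T T ε f x +
      δ * (P.γ * ∑ i : Fin N, ((if i.val = 0 then 1 / 2 * partialP i (partialP i f) x else 0) +
        (if i.val = N - 1 then -(1 / 2) * partialP i (partialP i f) x else 0))) := by
  simp only [OscillatorChain.flipGenerator_eq_add_flipNoise]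
  have h := generator_temp_split P N T (δ / 2) (-(δ / 2)) f x
  rw [show T + -(δ / 2) = T - δ / 2 by ring] at h
  rw [h, Finset.mul_sum, Finset.mul_sum, Finset.mul_sum]
  have e : ∀ i : Fin N, P.γ * ((if i.val = 0 then δ / 2 * partialP i (partialP i f) x else 0) +
      (if i.val = N - 1 then -(δ / 2) * partialP i (partialP i f) x else 0)) =
      δ * (P.γ * ((if i.val = 0 then 1 / 2 * partialP i (partialP i f) x else 0) +
        (if i.val = N - 1 then -(1 / 2) * partialP i (partialP i f) x else 0))) := by
    intro i
    split_ifs <;> ring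
  simp only [e]
  ring

/-! ### Compact support and `L²` membership of the test vectors -/

/-- A finite sum of compactly supported functions is compactly supported. -/
theorem hasCompactSupport_finset_sum {α ι : Type*} [TopologicalSpace α] (s : Finset ι)
    {g : ι → α → ℝ} (h : ∀ i ∈ s, HasCompactSupport (g i)) :
    HasCompactSupport (fun x => ∑ i ∈ s, g i x) := by
  classical
  induction s using Finset.induction_on with
  | empty =>
    simp only [Finset.sum_empty]
    exact HasCompactSupport.zero
  | insert a s ha ih =>
    simp only [Finset.sum_insert ha]
    exact (h a (Finset.mem_insert_self a s)).add
      (ih fun i hi => h i (Finset.mem_insert_of_mem hi))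

/-- A continuous compactly supported function is in every `L^p` of a finite measure. -/
theorem memLp_of_continuous_hasCompactSupport {f : PhaseSpace N → ℝ} (hf : Continuous f)
    (hfc : HasCompactSupport f) (μ : Measure (PhaseSpace N)) [IsFiniteMeasure μ] (p : ENNReal) :
    MemLp f p μ := by
  obtain ⟨C, hC⟩ := hf.bounded_above_of_compact_support hfc
  exact MemLp.of_bound hf.aestronglyMeasurable C (Eventually.of_forall hC)

/-- `f ∘ Θ_i` has compact support if `f` has (`Θ_i` is a homeomorphism). -/
theorem hasCompactSupport_comp_momentumFlip {f : PhaseSpace N → ℝ} (hfc : HasCompactSupport f)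
    (i : Fin N) : HasCompactSupport (fun x => f (momentumFlip i x)) :=
  hfc.comp_homeomorph
    (⟨⟨momentumFlip i, momentumFlip i, momentumFlip_momentumFlip i, momentumFlip_momentumFlip i⟩,
      continuous_momentumFlip i, continuous_momentumFlip i⟩ : PhaseSpace N ≃ₜ PhaseSpace N)

/-- For the pinned chain and `f ∈ C_c^∞`, `(L + εS) f` has compact support. -/
theorem hasCompactSupport_flipGenerator (ω₂ lam β γ : ℝ) (N : ℕ) (T_L T_R ε : ℝ)
    {f : PhaseSpace N → ℝ} (hf : ContDiff ℝ ∞ f) (hfc : HasCompactSupport f) :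
    HasCompactSupport ((pinnedChain ω₂ lam β γ).flipGenerator N T_L T_R ε f) := by
  have h1 : HasCompactSupport ((pinnedChain ω₂ lam β γ).generator N T_L T_R f) :=
    (pinnedChain ω₂ lam β γ).hasCompactSupport_generator N T_L T_R (hf.of_le (by norm_cast)) hfc
  have h2 : HasCompactSupport (fun x => ε * ∑ i : Fin N, (f (momentumFlip i x) - f x)) :=
    (hasCompactSupport_finset_sum Finset.univ fun i _ =>
      (hasCompactSupport_comp_momentumFlip hfc i).sub hfc).mul_left
  have e : (pinnedChain ω₂ lam β γ).flipGenerator N T_L T_R ε f =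
      fun x => (pinnedChain ω₂ lam β γ).generator N T_L T_R f x +
        ε * ∑ i : Fin N, (f (momentumFlip i x) - f x) :=
    funext fun x => (pinnedChain ω₂ lam β γ).flipGenerator_apply N T_L T_R ε f x
  rw [e]
  exact h1.add h2

/-- For the pinned chain and `f ∈ C^∞`, `(L + εS) f` is continuous. -/
theorem continuous_flipGenerator (ω₂ lam β γ : ℝ) (N : ℕ) (T_L T_R ε : ℝ)
    {f : PhaseSpace N → ℝ} (hf : ContDiff ℝ ∞ f) :
    Continuous ((pinnedChain ω₂ lam β γ).flipGenerator N T_L T_R ε f) := by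
  have h1 : Continuous ((pinnedChain ω₂ lam β γ).generator N T_L T_R f) :=
    (pinnedChain ω₂ lam β γ).continuous_generator (pinnedChain_contDiff_U ω₂ lam β γ)
      (pinnedChain_contDiff_V ω₂ lam β γ) N T_L T_R (hf.of_le (by norm_cast))
  have e : (pinnedChain ω₂ lam β γ).flipGenerator N T_L T_R ε f =
      fun x => (pinnedChain ω₂ lam β γ).generator N T_L T_R f x +
        ε * ∑ i : Fin N, (f (momentumFlip i x) - f x) :=
    funext fun x => (pinnedChain ω₂ lam β γ).flipGenerator_apply N T_L T_R ε f x
  rw [e]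
  exact h1.add (continuous_const.mul (continuous_finsetSum _ fun i _ =>
    (hf.continuous.comp (continuous_momentumFlip i)).sub hf.continuous))

/-- For the pinned chain and `f ∈ C_c^∞`, `(L + εS) f ∈ L^p` of every finite measure. -/
theorem memLp_flipGenerator (ω₂ lam β γ : ℝ) (N : ℕ) (T_L T_R ε : ℝ)
    {f : PhaseSpace N → ℝ} (hf : ContDiff ℝ ∞ f) (hfc : HasCompactSupport f)
    (μ : Measure (PhaseSpace N)) [IsFiniteMeasure μ] (p : ENNReal) :
    MemLp ((pinnedChain ω₂ lam β γ).flipGenerator N T_L T_R ε f) p μ :=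
  memLp_of_continuous_hasCompactSupport (continuous_flipGenerator ω₂ lam β γ N T_L T_R ε hf)
    (hasCompactSupport_flipGenerator ω₂ lam β γ N T_L T_R ε hf hfc) μ p

/-- The temperature derivative `V f = γ ∑_i ([i=0]½ - [i=N-1]½) ∂²_{p_i} f` of the generator is
continuous for `f ∈ C^∞`. -/
theorem continuous_tempDeriv (P : OscillatorChain) {f : PhaseSpace N → ℝ} (hf : ContDiff ℝ ∞ f) :
    Continuous fun x => P.γ * ∑ i : Fin N,
      ((if i.val = 0 then 1 / 2 * partialP i (partialP i f) x else 0) +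
        (if i.val = N - 1 then -(1 / 2) * partialP i (partialP i f) x else 0)) := by
  have hP1 : ∀ i : Fin N, ContDiff ℝ ∞ (partialP i f) := fun i =>
    contDiff_partialP hf (m := ∞) (by exact_mod_cast le_top) i
  have hP2 : ∀ i : Fin N, Continuous (partialP i (partialP i f)) := fun i =>
    continuous_partialP (hP1 i) (by simp) i
  refine continuous_const.mul (continuous_finsetSum _ fun i _ => ?_)
  refine Continuous.add ?_ ?_
  · split_ifs
    · exact continuous_const.mul (hP2 i)
    · exact continuous_const
  · split_ifs
    · exact continuous_const.mul (hP2 i)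
    · exact continuous_const

/-- The temperature derivative `V f` has compact support for `f ∈ C_c^∞`. -/
theorem hasCompactSupport_tempDeriv (P : OscillatorChain) {f : PhaseSpace N → ℝ}
    (hf : ContDiff ℝ ∞ f) (hfc : HasCompactSupport f) :
    HasCompactSupport fun x => P.γ * ∑ i : Fin N,
      ((if i.val = 0 then 1 / 2 * partialP i (partialP i f) x else 0) +
        (if i.val = N - 1 then -(1 / 2) * partialP i (partialP i f) x else 0)) := by
  have hpp : ∀ i : Fin N, HasCompactSupport (partialP i (partialP i f)) := fun i =>
    (contDiff_hasCompactSupport_partialP_partialP hf hfc i).2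
  refine (hasCompactSupport_finset_sum Finset.univ fun i _ => ?_).mul_left
  refine HasCompactSupport.add ?_ ?_
  · split_ifs
    · exact (hpp i).mul_left
    · exact HasCompactSupport.zero
  · split_ifs
    · exact (hpp i).mul_left
    · exact HasCompactSupport.zero

/-- The temperature derivative `V f ∈ L^p` of every finite measure, for `f ∈ C_c^∞`. -/
theorem memLp_tempDeriv (P : OscillatorChain) {f : PhaseSpace N → ℝ}
    (hf : ContDiff ℝ ∞ f) (hfc : HasCompactSupport f)
    (μ : Measure (PhaseSpace N)) [IsFiniteMeasure μ] (p : ENNReal) :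
    MemLp (fun x => P.γ * ∑ i : Fin N,
      ((if i.val = 0 then 1 / 2 * partialP i (partialP i f) x else 0) +
        (if i.val = N - 1 then -(1 / 2) * partialP i (partialP i f) x else 0))) p μ :=
  memLp_of_continuous_hasCompactSupport (continuous_tempDeriv P hf)
    (hasCompactSupport_tempDeriv P hf hfc) μ p

/-- **The bond currents of the pinned chain are in `L²(μ_T)`** (`ω₂ > 0`, `lam, β ≥ 0`, `T > 0`):
`j_i² ≤ (N(3+β)/2)² (1+H)^4` and `(1+H)^4 e^{-H/T}` is integrable. -/
theorem memLp_bondCurrent_gibbsMeasure {ω₂ lam β : ℝ} (hω : 0 < ω₂) (hl : 0 ≤ lam) (hβ : 0 ≤ β)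
    (γ : ℝ) (N : ℕ) {T : ℝ} (hT : 0 < T) (i : Fin N) :
    MemLp ((pinnedChain ω₂ lam β γ).bondCurrent N i) 2 ((pinnedChain ω₂ lam β γ).gibbsMeasure N T) := by
  have hc := pinnedChain_continuous_bondCurrent ω₂ lam β γ N i
  rw [memLp_two_iff_integrable_sq hc.aestronglyMeasurable]
  refine (pinnedChain ω₂ lam β γ).integrable_gibbsMeasure ?_
  refine LightConeBondHeat.pinnedChain_integrable_mul_gibbsDensity_of_le_pow hω hl hβ γ N hT 4
    (hc.pow 2) (C := ((N : ℝ) * ((3 + β) / 2)) ^ 2) fun x => ?_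
  have h := pinnedChain_abs_bondCurrent_le hω.le hl hβ γ N i x
  rw [abs_pow]
  calc |(pinnedChain ω₂ lam β γ).bondCurrent N i x| ^ 2
      ≤ ((N : ℝ) * ((3 + β) / 2 * (1 + (pinnedChain ω₂ lam β γ).hamiltonian N x) ^ 2)) ^ 2 :=
        pow_le_pow_left₀ (abs_nonneg _) h 2
    _ = ((N : ℝ) * ((3 + β) / 2)) ^ 2 * (1 + (pinnedChain ω₂ lam β γ).hamiltonian N x) ^ 4 := by
        ring

/-! ### `L²(μ)` inner products of representatives as integrals -/

/-- `⟪w, F⟫_{L²(μ)} = ∫ w F dμ` for `w ∈ L²(μ)` and the class of an `L²` function `F`. -/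
theorem inner_toLp_eq_integral {μ : Measure (PhaseSpace N)} (w : Lp ℝ 2 μ)
    {F : PhaseSpace N → ℝ} (hF : MemLp F 2 μ) :
    ⟪w, hF.toLp F⟫_ℝ = ∫ x, w x * F x ∂μ := by
  rw [MeasureTheory.L2.inner_def]
  refine integral_congr_ae ?_
  filter_upwards [hF.coeFn_toLp] with x hx
  rw [hx]
  simp only [RCLike.inner_apply, conj_trivial]
  ring

/-- `⟪k, F⟫_{L²(μ)} = ∫ k F dμ` for the classes of two `L²` functions. -/
theorem inner_toLp_toLp_eq_integral {μ : Measure (PhaseSpace N)} {k F : PhaseSpace N → ℝ}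
    (hk : MemLp k 2 μ) (hF : MemLp F 2 μ) :
    ⟪hk.toLp k, hF.toLp F⟫_ℝ = ∫ x, k x * F x ∂μ := by
  rw [inner_toLp_eq_integral]
  refine integral_congr_ae ?_
  filter_upwards [hk.coeFn_toLp] with x hx
  rw [hx]

/-- `‖k‖_{L²(μ)} ≤ √C` whenever `∫ k² dμ ≤ C`. -/
theorem norm_toLp_le_sqrt {μ : Measure (PhaseSpace N)} {k : PhaseSpace N → ℝ} (hk : MemLp k 2 μ)
    {C : ℝ} (hC : ∫ x, k x ^ 2 ∂μ ≤ C) : ‖hk.toLp k‖ ≤ Real.sqrt C := by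
  have h : ‖hk.toLp k‖ ^ 2 = ∫ x, k x ^ 2 ∂μ := by
    rw [← real_inner_self_eq_norm_sq, inner_toLp_toLp_eq_integral hk hk]
    exact integral_congr_ae (Eventually.of_forall fun x => by simp only; ring)
  have := Real.abs_le_sqrt (h ▸ hC)
  rwa [abs_of_nonneg (norm_nonneg _)] at this

/-! ### Weak convergence of a bounded net in a Hilbert space from convergence of its moments -/

section Hilbert

variable {H : Type*} [NormedAddCommGroup H] [InnerProductSpace ℝ H] [CompleteSpace H]

/-- **Weak convergence from bounded + convergent moments + uniqueness.** In a real Hilbert space,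
a net `v i` bounded along a (proper) filter `l`, whose inner products against a family `e j`
converge to `c j`, converges weakly to the unique solution `u` of `⟪u, e j⟫ = c j` (all `j`) as soon
as that system has at most one solution; moreover `‖u‖ ≤ C`. (Banach–Alaoglu + uniqueness of the
cluster point.) -/
theorem exists_tendsto_inner_of_norm_le {ι : Type*} {l : Filter ι} [NeBot l] (v : ι → H) {C : ℝ}
    (hb : ∀ᶠ i in l, ‖v i‖ ≤ C) {J : Type*} (e : J → H) (c : J → ℝ)
    (hconv : ∀ j, Tendsto (fun i => ⟪v i, e j⟫_ℝ) l (𝓝 (c j)))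
    (huniq : ∀ u u' : H, (∀ j, ⟪u, e j⟫_ℝ = c j) → (∀ j, ⟪u', e j⟫_ℝ = c j) → u = u') :
    ∃ u : H, (∀ j, ⟪u, e j⟫_ℝ = c j) ∧ ‖u‖ ≤ C ∧
      ∀ w : H, Tendsto (fun i => ⟪v i, w⟫_ℝ) l (𝓝 ⟪u, w⟫_ℝ) := by
  classical
  -- the net in the weak dual, via the Riesz isometry
  set Φ : ι → WeakDual ℝ H := fun i =>
    StrongDual.toWeakDual (InnerProductSpace.toDual ℝ H (v i)) with hΦ
  have hΦapply : ∀ i w, Φ i w = ⟪v i, w⟫_ℝ := fun i w => rfl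
  -- the weak-* compact ball of radius `C`
  set K : Set (WeakDual ℝ H) :=
    WeakDual.toStrongDual ⁻¹' Metric.closedBall (0 : StrongDual ℝ H) C with hK
  have hKc : IsCompact K := WeakDual.isCompact_closedBall (0 : StrongDual ℝ H) C
  have hmem : ∀ᶠ i in l, Φ i ∈ K := by
    filter_upwards [hb] with i hi
    show WeakDual.toStrongDual (Φ i) ∈ Metric.closedBall (0 : StrongDual ℝ H) C
    rw [Metric.mem_closedBall, dist_zero_right]
    simpa [hΦ] using hi
  -- the representing vector of a weak-dual element
  set rep : WeakDual ℝ H → H := fun ψ =>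
    (InnerProductSpace.toDual ℝ H).symm (WeakDual.toStrongDual ψ) with hrep_def
  have hrep : ∀ ψ w, ⟪rep ψ, w⟫_ℝ = ψ w := fun ψ w => by
    simp only [hrep_def, InnerProductSpace.toDual_symm_apply]
    rfl
  -- every cluster point solves the equations
  have hsol : ∀ ψ, MapClusterPt ψ l Φ → ∀ j, ⟪rep ψ, e j⟫_ℝ = c j := by
    intro ψ hψ j
    rw [hrep]
    have h1 : MapClusterPt (ψ (e j)) l ((fun χ : WeakDual ℝ H => χ (e j)) ∘ Φ) :=
      hψ.continuousAt_comp (WeakDual.eval_continuous (e j)).continuousAt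
    have h2 : Tendsto ((fun χ : WeakDual ℝ H => χ (e j)) ∘ Φ) l (𝓝 (c j)) := by
      simpa only [Function.comp_def, hΦapply] using hconv j
    exact eq_of_nhds_neBot (h1.clusterPt.mono h2)
  -- a cluster point exists (Banach–Alaoglu)
  obtain ⟨ψ₀, hψ₀K, hψ₀⟩ : ∃ ψ ∈ K, MapClusterPt ψ l Φ :=
    hKc.exists_mapClusterPt (le_principal_iff.2 (mem_map.2 hmem))
  -- and is unique
  have hone : ∀ ψ ∈ K, MapClusterPt ψ l Φ → ψ = ψ₀ := by
    intro ψ _ hψ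
    have h := huniq (rep ψ) (rep ψ₀) (hsol ψ hψ) (hsol ψ₀ hψ₀)
    have h' : WeakDual.toStrongDual ψ = WeakDual.toStrongDual ψ₀ :=
      (InnerProductSpace.toDual ℝ H).symm.injective h
    exact (WeakDual.toStrongDual_inj ψ ψ₀).1 h'
  have hlim : Tendsto Φ l (𝓝 ψ₀) := hKc.tendsto_nhds_of_unique_mapClusterPt hmem hone
  refine ⟨rep ψ₀, hsol ψ₀ hψ₀, ?_, fun w => ?_⟩
  · have h : ‖WeakDual.toStrongDual ψ₀‖ ≤ C := by
      have h := hψ₀K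
      rwa [hK, Set.mem_preimage, Metric.mem_closedBall, dist_zero_right] at h
    simpa [hrep_def] using h
  · have h := ((WeakDual.eval_continuous w).tendsto ψ₀).comp hlim
    rw [hrep]
    simpa only [Function.comp_def, hΦapply] using h

end Hilbert

/-! ### Registered helper sub-goal (stub form, one line) -/

/-- Registered helper sub-goal `helper_responseDensityNoisyMemLpBondCurrent` of stub
`stub_responseDensityNoisy` (= `memLp_bondCurrent_gibbsMeasure` in stub form): the bond currents of
the pinned chain are square-integrable for the Gibbs measure. -/
theorem helper_responseDensityNoisyMemLpBondCurrent : ∀ ω₂ lam β γ : ℝ, 0 < ω₂ → 0 ≤ lam → 0 ≤ β → ∀ (N : ℕ) (T : ℝ), 0 < T → ∀ i : Fin N, MeasureTheory.MemLp ((Literature.MathematicalPhysics.KineticTheory.HeatConduction.pinnedChain ω₂ lam β γ).bondCurrent N i) 2 ((Literature.MathematicalPhysics.KineticTheory.HeatConduction.pinnedChain ω₂ lam β γ).gibbsMeasure N T) :=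
  fun _ _ _ γ hω hl hβ N _ hT i => memLp_bondCurrent_gibbsMeasure hω hl hβ γ N hT i

end Summit.AtomisticToContinuum.FouriersLaw.Theorems.NoiseLocality.StubResponseDensityNoisy

end
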